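import Summits.ValiantsHypothesis.ValiantsHypothesis.Theorems.BarrierLeverPartitionMinorsSubsetSumFrobenius
import Summits.ValiantsHypothesis.ValiantsHypothesis.Theorems.BarrierLeverPartitionMinorsHitByVPAdditiveDoor
import Summits.ValiantsHypothesis.ValiantsHypothesis.Theorems.BarrierLeverPartitionMinorsHitByVPOrProjections

/-!
# Route BarrierLever — item `PartitionMinorsHitByVP` (stmt-ValiantsHypothesis-19717):
# ALL row families × BINARY-CONTIGUOUS column families are hit (the reach of the Frobenius table)

Helper file (`--supports stmt-ValiantsHypothesis-19717`; cell valiant-natproofs, rung V4, 𝒟-side door (c),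
prover seat val-np-p1, gen 10). Closes NO item; definition-free. Sequel of `…SubsetSumFrobenius` (engine v3,
faces) in the item's OWN indexing (`u w : Fin r → Finset (Fin h)`), through the additive door
`AdditiveDoor.partitionMinor_hit_of_additive_mem` (val-np-p6 g3) and its mirror `partitionMinor_hit_symm`.

Call a column family `w` BINARY-CONTIGUOUS (modulo a neutral coordinate set `Z`, for a weight
`e : Fin h → ℕ`) if the binary weights `E j := Σ_{c ∈ w j \ Z} 2^{e c}` are exactly `0, 1, …, r − 1` in some
order (`E j = σ j` for a permutation `σ` of `Fin r`). Examples: a `κ`-face `[W₀, W₀ ⊔ T]` (`Z ⊇ W₀` off `T`,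
`e` an enumeration of `T`, `r = 2^κ`; file `…AllRowsFaces`); a face in which every member `W₀ ∪ S` may carry its
own arbitrary extra elements of equal `e`-weight pattern; columns whose sizes outside `Z` are `0, 1, …, r−1`
(`e ≡ 0`); mixtures (blocks of equal weight = digits with carries).

**Theorem (`partitionMinor_hit_of_binaryContiguous`).** `h ≥ 2`; rows `u : Fin r → Finset (Fin h)` injective
and OTHERWISE ARBITRARY; columns `w` binary-contiguous. Then `∃ f ∈ SmallCircuits ℂ (h+h) 5` with
`det [coeff_{x^{u i} y^{w j}} f]_{i,j} ≠ 0`. Mirror: `partitionMinor_hit_of_binaryContiguous_rows`.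

*Proof.* The integer additive matrix `[∏_{c ∈ w j} (X_(c,none) + Σ_{a ∈ u i} X_(c,some a))]` evaluated in
`𝔽₂[t]` at the table `X_(c,none) ↦ [c ∈ Z]`, `X_(c,some a) ↦ [c ∉ Z]·t^(a·2^{e c})` has entry
`ξ_{u i}^{E j}` (Frobenius additivity, `ξ_U = Σ_{k∈U} t^k` the injective code polynomial of
`…SubsetSumFrobenius`), i.e. it is the Vandermonde matrix of the distinct `ξ_{u i}` with columns permuted by
`σ`; nonzero determinant in the domain `𝔽₂[t]` ⇒ nonzero integer polynomial ⇒ a complex table exists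
(`exists_table_of_binaryContiguous`) ⇒ the door.

WHAT THIS IS NOT: if the weights `E j` are distinct but NOT contiguous the evaluated matrix is a generalized
Vandermonde whose Schur factor can vanish mod 2 (rows `{1},{2},{1,3},{2,3}` × columns `∅,{a},{b},{a,b,c}`),
and the additive door itself cannot hit every layout (columns of size `≤ 1` × affinely dependent rows are
identically singular) — item 19717 stays open; nothing on CPM (20172/20195), crux 14610 or VP vs VNP.
-/

set_option linter.dupNamespace false

namespace Summit.ValiantsHypothesis.ValiantsHypothesis.Theorems.BarrierLever.SubsetSum

open Finset MvPolynomial Literature.Barriers.ValiantsHypothesis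
open Summit.ValiantsHypothesis.ValiantsHypothesis.Theorems.BarrierLever.AdditiveDoor
  (partitionMinor_hit_of_additive_mem partitionMinor_hit_symm)

noncomputable section

variable {h : ℕ}

/-! ## 1. The Frobenius table with a neutral set -/

/-- Frobenius additivity with a neutral set: at `X_(c,none) ↦ [c ∈ Z]`, `X_(c,some a) ↦ [c ∉ Z]·t^(a·2^{e c})`
the coordinate form of `U` becomes `1` for `c ∈ Z` and `ξ_U^(2^{e c})` for `c ∉ Z`. -/
theorem frobZ_lin (Z : Finset (Fin h)) (e : Fin h → ℕ) (c : Fin h) (U : Finset (Fin h)) :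
    eval₂Hom (Int.castRingHom (Polynomial (ZMod 2)))
        (fun p : Fin h × Option (Fin h) =>
          Option.elim p.2 (if p.1 ∈ Z then 1 else 0) fun a =>
            if p.1 ∈ Z then 0 else (Polynomial.X : Polynomial (ZMod 2)) ^ ((a : ℕ) * 2 ^ e p.1))
        (X (c, none) + ∑ a ∈ U, X (c, some a) : MvPolynomial (Fin h × Option (Fin h)) ℤ) =
      if c ∈ Z then 1 else (∑ j ∈ U, (Polynomial.X : Polynomial (ZMod 2)) ^ (j : ℕ)) ^ 2 ^ e c := by
  simp only [map_add, map_sum, coe_eval₂Hom, eval₂_X, Option.elim]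
  split_ifs with hc
  · simp
  · rw [zero_add, sum_pow_char_pow 2 (e c) U]
    refine Finset.sum_congr rfl fun k _ => ?_
    rw [← pow_mul]

/-- The evaluated entry is `ξ_U^(Σ_{c ∈ W \ Z} 2^{e c})`. -/
theorem frobZ_entry (Z : Finset (Fin h)) (e : Fin h → ℕ) (U W : Finset (Fin h)) :
    eval₂Hom (Int.castRingHom (Polynomial (ZMod 2)))
        (fun p : Fin h × Option (Fin h) =>
          Option.elim p.2 (if p.1 ∈ Z then 1 else 0) fun a =>
            if p.1 ∈ Z then 0 else (Polynomial.X : Polynomial (ZMod 2)) ^ ((a : ℕ) * 2 ^ e p.1))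
        (∏ c ∈ W, (X (c, none) + ∑ a ∈ U, X (c, some a)) : MvPolynomial (Fin h × Option (Fin h)) ℤ) =
      (∑ j ∈ U, (Polynomial.X : Polynomial (ZMod 2)) ^ (j : ℕ)) ^ (∑ c ∈ W \ Z, 2 ^ e c) := by
  rw [map_prod, ← Finset.prod_pow_eq_pow_sum, Finset.sdiff_eq_filter, Finset.prod_filter]
  refine Finset.prod_congr rfl fun c _ => ?_
  rw [frobZ_lin]
  split_ifs <;> rfl

/-! ## 2. Nonsingularity of the integer additive matrix -/

/-- **Binary-contiguous columns × any injective rows: the integer additive matrix is nonsingular.** -/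
theorem det_additiveZ_ne_zero_of_binaryContiguous {r : ℕ} (u w : Fin r → Finset (Fin h))
    (hu : Function.Injective u) (Z : Finset (Fin h)) (e : Fin h → ℕ) (σ : Equiv.Perm (Fin r))
    (hw : ∀ j, ∑ c ∈ w j \ Z, 2 ^ e c = (σ j : ℕ)) :
    (Matrix.of fun i j : Fin r =>
      (∏ c ∈ w j, (X (c, none) + ∑ a ∈ u i, X (c, some a)) :
        MvPolynomial (Fin h × Option (Fin h)) ℤ)).det ≠ 0 := by
  let ψ : MvPolynomial (Fin h × Option (Fin h)) ℤ →+* Polynomial (ZMod 2) :=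
    eval₂Hom (Int.castRingHom (Polynomial (ZMod 2)))
      (fun p : Fin h × Option (Fin h) =>
        Option.elim p.2 (if p.1 ∈ Z then 1 else 0) fun a =>
          if p.1 ∈ Z then 0 else (Polynomial.X : Polynomial (ZMod 2)) ^ ((a : ℕ) * 2 ^ e p.1))
  let ξ : Finset (Fin h) → Polynomial (ZMod 2) := fun U =>
    ∑ j ∈ U, (Polynomial.X : Polynomial (ZMod 2)) ^ (j : ℕ)
  -- the evaluated matrix is the Vandermonde matrix with columns permuted by `σ`
  have hmat : ψ.mapMatrix (Matrix.of fun i j : Fin r =>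
      (∏ c ∈ w j, (X (c, none) + ∑ a ∈ u i, X (c, some a)) :
        MvPolynomial (Fin h × Option (Fin h)) ℤ)) =
      (Matrix.vandermonde fun i : Fin r => ξ (u i)).submatrix id σ := by
    refine Matrix.ext fun i j => ?_
    rw [RingHom.mapMatrix_apply, Matrix.map_apply, Matrix.of_apply, Matrix.submatrix_apply,
      Matrix.vandermonde_apply, id, ← hw j]
    exact frobZ_entry Z e (u i) (w j)
  have hV : (Matrix.vandermonde fun i : Fin r => ξ (u i)).det ≠ 0 :=
    Matrix.det_vandermonde_ne_zero_iff.mpr (codePoly_injective.comp hu)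
  have hdet : (ψ.mapMatrix (Matrix.of fun i j : Fin r =>
      (∏ c ∈ w j, (X (c, none) + ∑ a ∈ u i, X (c, some a)) :
        MvPolynomial (Fin h × Option (Fin h)) ℤ))).det ≠ 0 := by
    rw [hmat, Matrix.det_permute']
    refine mul_ne_zero ?_ hV
    rcases Int.units_eq_one_or (Equiv.Perm.sign σ) with h1 | h1 <;> simp [h1]
  intro h0
  apply hdet
  rw [← RingHom.map_det, h0, map_zero]

/-! ## 3. A complex table, and the door -/

/-- **A complex additive table exists** for binary-contiguous columns × any injective rows: numbers
`ω₀, ω` with `det [∏_{c ∈ w j} (ω₀ c + Σ_{a ∈ u i} ω a c)] ≠ 0` (the additive door's hypothesis). -/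
theorem exists_table_of_binaryContiguous {r : ℕ} (u w : Fin r → Finset (Fin h))
    (hu : Function.Injective u) (Z : Finset (Fin h)) (e : Fin h → ℕ) (σ : Equiv.Perm (Fin r))
    (hw : ∀ j, ∑ c ∈ w j \ Z, 2 ^ e c = (σ j : ℕ)) :
    ∃ (ω₀ : Fin h → ℂ) (ω : Fin h → Fin h → ℂ),
      (Matrix.of fun i j : Fin r => ∏ c ∈ w j, (ω₀ c + ∑ a ∈ u i, ω a c)).det ≠ 0 := by
  set P : MvPolynomial (Fin h × Option (Fin h)) ℤ := (Matrix.of fun i j : Fin r =>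
      (∏ c ∈ w j, (X (c, none) + ∑ a ∈ u i, X (c, some a)) :
        MvPolynomial (Fin h × Option (Fin h)) ℤ)).det with hP
  have hPne : P ≠ 0 := det_additiveZ_ne_zero_of_binaryContiguous u w hu Z e σ hw
  have hPC : MvPolynomial.map (Int.castRingHom ℂ) P ≠ 0 := fun h0 =>
    hPne (MvPolynomial.map_injective (Int.castRingHom ℂ) Int.cast_injective (by rw [h0, map_zero]))
  have : ∃ x : Fin h × Option (Fin h) → ℂ, eval x (MvPolynomial.map (Int.castRingHom ℂ) P) ≠ 0 := by
    by_contra hcon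
    push Not at hcon
    exact hPC (MvPolynomial.funext fun x => by rw [hcon x, map_zero])
  obtain ⟨x, hx⟩ := this
  refine ⟨fun c => x (c, none), fun a c => x (c, some a), ?_⟩
  rw [MvPolynomial.eval_map, ← coe_eval₂Hom, hP, RingHom.map_det] at hx
  convert hx using 2
  refine Matrix.ext fun i j => ?_
  simp only [Matrix.of_apply, RingHom.mapMatrix_apply, Matrix.map_apply, map_prod, map_add, map_sum,
    eval₂Hom_X']

/-- **ALL rows × BINARY-CONTIGUOUS columns are hit** (`h ≥ 2`, `b = 5`): rows `u` injective and otherwise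
arbitrary; columns `w` with binary weights `Σ_{c ∈ w j \ Z} 2^{e c}` a permutation of `0, …, r−1`. -/
theorem partitionMinor_hit_of_binaryContiguous (hh : 2 ≤ h) {r : ℕ} (u w : Fin r → Finset (Fin h))
    (hu : Function.Injective u) (Z : Finset (Fin h)) (e : Fin h → ℕ) (σ : Equiv.Perm (Fin r))
    (hw : ∀ j, ∑ c ∈ w j \ Z, 2 ^ e c = (σ j : ℕ)) :
    ∃ f ∈ SmallCircuits ℂ (h + h) 5,
      (Matrix.of fun i j : Fin r => MvPolynomial.coeff
        (∑ a ∈ u i, Finsupp.single (Fin.castAdd h a) 1 +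
          ∑ c ∈ w j, Finsupp.single (Fin.natAdd h c) 1) f).det ≠ 0 := by
  obtain ⟨ω₀, ω, hdet⟩ := exists_table_of_binaryContiguous u w hu Z e σ hw
  exact partitionMinor_hit_of_additive_mem h hh u w ω₀ ω hdet

/-- **BINARY-CONTIGUOUS rows × ALL columns are hit** (`x ↔ y` mirror). -/
theorem partitionMinor_hit_of_binaryContiguous_rows (hh : 2 ≤ h) {r : ℕ} (u w : Fin r → Finset (Fin h))
    (hw : Function.Injective w) (Z : Finset (Fin h)) (e : Fin h → ℕ) (σ : Equiv.Perm (Fin r))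
    (hu : ∀ i, ∑ c ∈ u i \ Z, 2 ^ e c = (σ i : ℕ)) :
    ∃ f ∈ SmallCircuits ℂ (h + h) 5,
      (Matrix.of fun i j : Fin r => MvPolynomial.coeff
        (∑ a ∈ u i, Finsupp.single (Fin.castAdd h a) 1 +
          ∑ c ∈ w j, Finsupp.single (Fin.natAdd h c) 1) f).det ≠ 0 :=
  partitionMinor_hit_symm h 5 u w (partitionMinor_hit_of_binaryContiguous hh w u hw Z e σ hu)

/-! ## 4. Example: graded sizes -/

/-- **Columns of sizes `0, 1, …, r−1` outside `Z`** (weight `e ≡ 0`) × ANY injective rows are hit. -/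
theorem partitionMinor_hit_of_cardGraded (hh : 2 ≤ h) {r : ℕ} (u w : Fin r → Finset (Fin h))
    (hu : Function.Injective u) (Z : Finset (Fin h)) (σ : Equiv.Perm (Fin r))
    (hw : ∀ j, (w j \ Z).card = (σ j : ℕ)) :
    ∃ f ∈ SmallCircuits ℂ (h + h) 5,
      (Matrix.of fun i j : Fin r => MvPolynomial.coeff
        (∑ a ∈ u i, Finsupp.single (Fin.castAdd h a) 1 +
          ∑ c ∈ w j, Finsupp.single (Fin.natAdd h c) 1) f).det ≠ 0 :=
  partitionMinor_hit_of_binaryContiguous hh u w hu Z (fun _ => 0) σ fun j => by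
    rw [← hw j, Finset.card_eq_sum_ones]
    simp

end

end Summit.ValiantsHypothesis.ValiantsHypothesis.Theorems.BarrierLever.SubsetSum
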